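import Summits.BirchSwinnertonDyer.BirchSwinnertonDyer.Theorems.EisensteinPrimesAcTwistDeformationCurveAlmostDivisible
import HarnessLib

/-!
# Greenberg 2016 Prop. 4.1.1 (c) AT THE CURVE DEFORMATION for the fullAt specification `𝓛_v = (⊤ at v, 0 elsewhere)`:
# `S_{𝓛_v}(K, 𝐃_E)` is ALMOST `Λ`-DIVISIBLE — the rank-`n` / curve twin of x1-w3 g2's corank-one `bigRep_fullAtSelmer_isAlmostDivisible`
# (cell `bsd-eis`, width seat `bsd-line-x2-p2` gen 7; helper for stmt-BirchSwinnertonDyer-19034, companion of p651263 — the `Sf`-imprimitive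
# specification `𝓛^{v̄}` is there; THIS is the PRIMITIVE one, whose Shapiro image is Castella's `Sel_{v̄}(K_∞, E[p^∞])`, `Σ = ∅`)

HONEST FRAMING (cell `bsd-eis`, run/shared/lean/pub/bsd-eis/): bookkeeping on Greenberg's arena; no definition, no named fact introduced,
no `sorry`, no `Theses` import; nothing about BSD or a main conjecture is asserted; nothing booked; no label or count moves. Helper
`--supports stmt-BirchSwinnertonDyer-19034`; closes no stub. CONDITIONAL BY NAME on Greenberg 2016 Prop. 4.1.1 and Greenberg 2006
Props. 4.1, 4.2, 3.2 [PUB]; Greenberg 2016 Prop. 4.2.2 / Greenberg 2006 §5 A are the tree's `_holds` theorems.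

* `bigRep_fullAtSelmer_isAlmostDivisible_of_dualBasis` — Prop. 4.1.1 (c) for `𝓛_η`, `η = v`, at the one-variable twist deformation
  `bigRep κ ρ₀` of a `p`-primary `A` of ANY corank `n` (dual-basis families over `ℚ/ℤ` and `K̄ˣ`), `K` imaginary quadratic, `p = v v̄`:
  LEO / CRK by x1-w3 g3's `bigRep_leo_crk_of_dualBasis`, RFX / cofree / LOC⁽²⁾ by `…CofreeRank`, the rest by k5-c2 g8's
  `GreenbergFullAtSelmer.fullAtSelmer_isAlmostDivisible_of_facts`; input `corank_Λ S_{𝓛_v}(K, 𝐃) = 0`.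
* **`primaryTorsion_fullAtSelmer_isAlmostDivisible`** — the curve `A = E[p^∞]`, `n = 2`: every Pontryagin dual of `S_{𝓛_v}(K, 𝐃_E)` has
  no non-zero pseudo-null submodule, GRANTED the four published facts by name and `corank_Λ S_{𝓛_v}(K, 𝐃_E) = 0` (x1-w3 g3's
  `hasCorank_fullAtSelmer_zero_of_xAc` supplies it from the cotorsion of the PRIMITIVE `X_ac(E/K_∞)`). With x1-w3 g3's INTO
  (`…CurveCotorsion`) and an ONTO for `𝓛_v` (the converse dictionary `loc_eq_zero_of_forall_conjH1_shapiroDescent_mem_awayKer` of p652003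
  at every `w ∈ Σ ∖ {v}`) this yields (N1)^∅ for the primitive dual exactly as p653203/p654300 do for `𝓛^{v̄}`; not done here.

References: [Greenberg2016Selmer] Prop. 4.1.1 (c) (§4.1 p. 15 L21–32), Prop. 4.2.2, §4.3 p. 20 L19–30; [Greenberg2006] Props. 3.2, 4.1,
4.2 (§4 A pp. 367–368), §5 A; [CastellaGrossiLeeSkinner2022] Cor. 1.4.3; [PollackWeston2011] App. A Prop. A.2.
-/

set_option autoImplicit false
set_option linter.dupNamespace false -- the summit namespace `…BirchSwinnertonDyer.BirchSwinnertonDyer.Theorems` (Sub = Summit, D-0017) trips it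

noncomputable section

open scoped Classical
open NumberField IsDedekindDomain Field Finset
open Literature.NumberTheory.EllipticCurves Literature.NumberTheory.GaloisRepresentations
  Literature.NumberTheory.IwasawaTheory Literature.NumberTheory.IwasawaTheory.Greenberg2016
  Literature.NumberTheory.IwasawaTheory.Greenberg2006
  Summit.BirchSwinnertonDyer.BirchSwinnertonDyer.Theorems.TwistDeformationCofree
  Summit.BirchSwinnertonDyer.BirchSwinnertonDyer.Theorems.GreenbergFullAtSelmer
  Summit.BirchSwinnertonDyer.BirchSwinnertonDyer.Theorems.SignedBaseChangeAcDivGreenbergSqueeze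

namespace Summit.BirchSwinnertonDyer.BirchSwinnertonDyer.Theorems.AcTwistDeformation

section DualBasisFullAt

variable {K : Type} [Field K] [NumberField K] {S : Set (HeightOneSpectrum (𝓞 K))} {p : ℕ} [Fact p.Prime]
  {A : Type} [AddCommGroup A] [Module ℤ_[p] A] [TopologicalSpace A] [DiscreteTopology A]
  [TopologicalSpace (PowerSeries ℤ_[p])] [IsTopologicalRing (PowerSeries ℤ_[p])]
  [IsTopologicalAddGroup (BigRepModule ℤ_[p] p A)]
  [ContinuousSMul (PowerSeries ℤ_[p]) (BigRepModule ℤ_[p] p A)]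
  (hS : ∀ v : HeightOneSpectrum (𝓞 K), ((p : ℕ) : 𝓞 K) ∈ v.asIdeal → v ∈ S)
  (κ : ZpExtension K p) (ρ₀ : ContinuousRep (GaloisGroupUnramifiedOutside K S) ℤ_[p] A) {n : ℕ}

/-- **Greenberg 2016 Prop. 4.1.1 (c) for `𝓛_v = (⊤ at v, 0 elsewhere)` at the one-variable twist deformation of a `p`-primary `A` of ANY
corank `n`** (x1-w3 g2's `bigRep_fullAtSelmer_isAlmostDivisible` is `n = 1`): `S_{𝓛_v}(K, 𝐃)` is almost `Λ`-divisible, GRANTED Greenberg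
2016 Prop. 4.1.1 and Greenberg 2006 Props. 4.1, 4.2, 3.2 by name, local `h⁰ = 0` and LOC⁽¹⁾ on `S`, and `corank_Λ S_{𝓛_v}(K, 𝐃) = 0`.
[cite: Greenberg2016Selmer, Prop. 4.1.1 (c) (§4.1 p. 15 L21–32), §4.3 p. 20 L19–30]
[cite: Greenberg2006, Prop. 3.2 p. 358, Props. 4.1–4.2 (§4 A pp. 367–368), §5 A (p. 373)] -/
theorem bigRep_fullAtSelmer_isAlmostDivisible_of_dualBasis (h411 : prop411_selmer_isAlmostDivisible)
    (h41 : prop41_globalEulerPoincareCorank) (h42 : prop42_localEulerPoincareCorank)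
    (h32 : prop32_cohomology_isCofinitelyGenerated)
    (hSf : S.Finite) (hK : IsImaginaryQuadratic K) (hA : ∀ a : A, ∃ k : ℕ, p ^ k • a = 0)
    (jQ : Fin n → (A →+ AddCircle (1 : ℚ)))
    (hinjQ : ∀ c : Fin n → ℤ_[p], (∀ a : A, ∑ k, jQ k (c k • a) = 0) → c = 0)
    (hsurjQ : ∀ φ : A →+ AddCircle (1 : ℚ), ∃ c : Fin n → ℤ_[p], ∀ a : A, φ a = ∑ k, jQ k (c k • a))
    (jU : Fin n → (A →+ DiscreteGaloisModule.UnitsCarrier K))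
    (hinjU : ∀ c : Fin n → ℤ_[p], (∀ a : A, ∑ k, jU k (c k • a) = 0) → c = 0)
    (hsurjU : ∀ φ : A →+ DiscreteGaloisModule.UnitsCarrier K, ∃ c : Fin n → ℤ_[p], ∀ a : A,
      φ a = ∑ k, jU k (c k • a))
    (h0loc : ∀ v : HeightOneSpectrum (𝓞 K), v ∈ S →
      HasCorank (PowerSeries ℤ_[p])
        ((localRep S (bigRep (κ.liftUnramifiedOutside S hS) ρ₀) (Sum.inr v)).H 0) 0)
    (hLOC1fin : ∀ v : HeightOneSpectrum (𝓞 K), v ∈ S →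
      LOC1 S (bigRep (κ.liftUnramifiedOutside S hS) ρ₀) (Sum.inr v))
    {𝔭 𝔭bar : HeightOneSpectrum (𝓞 K)} (hne : 𝔭bar ≠ 𝔭)
    (hp𝔭 : ((p : ℕ) : 𝓞 K) ∈ 𝔭.asIdeal) (hp𝔭bar : ((p : ℕ) : 𝓞 K) ∈ 𝔭bar.asIdeal)
    (hSel : HasCorank (PowerSeries ℤ_[p])
      (fullAtSpecification S (bigRep (κ.liftUnramifiedOutside S hS) ρ₀) (Sum.inr 𝔭)).selmer 0) :
    IsAlmostDivisible (PowerSeries ℤ_[p])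
      (fullAtSpecification S (bigRep (κ.liftUnramifiedOutside S hS) ρ₀) (Sum.inr 𝔭)).selmer := by
  have hΛ := nonempty_iwasawaAlgebra_ringEquiv_mvPowerSeries p
  have hcpl := isAdicComplete_maximalIdeal_iwasawaAlgebra p
  have hres := finite_residueField_iwasawaAlgebra p
  have hchar := charP_residueField_iwasawaAlgebra p
  have hinjΛ : Function.Injective (algebraMap (PowerSeries ℤ_[p]) (PowerSeries ℤ_[p])) :=
    fun a b h ↦ by simpa using h
  have hfin : Module.Finite (PowerSeries ℤ_[p]) (PowerSeries ℤ_[p]) := inferInstance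
  have hlin : ∀ (g : GaloisGroupUnramifiedOutside K S) (r : PowerSeries ℤ_[p]) (d : BigRepModule ℤ_[p] p A),
      bigRep (κ.liftUnramifiedOutside S hS) ρ₀ g (r • d) = r • bigRep (κ.liftUnramifiedOutside S hS) ρ₀ g d :=
    fun g r d ↦ map_smul (bigRep (κ.liftUnramifiedOutside S hS) ρ₀ g) r d
  have hT := isCofree_bigRepModule_pi hA jQ hinjQ hsurjQ
  have hcf := isCofinitelyGenerated_bigRepModule_pi hA jQ hinjQ hsurjQ
  have hRFX := rfx_bigRepModule_pi hA jQ hinjQ hsurjQ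
  have hpD : ∀ d : BigRepModule ℤ_[p] p A, ∃ n : ℕ, (p ^ n : ℤ) • d = 0 := exists_zpow_smul_eq_zero
  haveI := hK.2
  have hKc : ∀ w : InfinitePlace K, w.IsComplex := IsTotallyComplex.isComplex
  -- LEO and CRK by the squeeze (x1-w3 g3, rank `n`)
  obtain ⟨hLEO, hCRK, -, -⟩ := bigRep_leo_crk_of_dualBasis hS κ ρ₀ h41 h42 sec5A_localH2_subsingleton_of_LOC1_holds h32
    hSf hK hA jQ hinjQ hsurjQ h0loc hLOC1fin hne hp𝔭 hp𝔭bar hSel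
  -- LOC⁽²⁾ on all of `Σ`
  have hLOC2 : ∀ v : Place K, InSigma S v → LOC2 S (bigRep (κ.liftUnramifiedOutside S hS) ρ₀) v := by
    rintro (w | v) hv
    · exact loc2_inl_of_isComplex S _ w (hKc w)
    · exact bigRep_LOC2_pi S hS κ ρ₀ hA jU hinjU hsurjU (Sum.inr v) (hLOC1fin v ((inSigma_inr_iff S v).mp hv))
  -- Prop. 4.1.1 (c) at `η = 𝔭`
  exact fullAtSelmer_isAlmostDivisible_of_facts h411 prop422_localCohomology_isAlmostDivisible_holds
    sec5A_localH2_subsingleton_of_LOC1_holds hSf hS hΛ hinjΛ hfin hcpl hres hchar hlin hT hcf hpD hRFX hLEO hLOC2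
    (hS 𝔭 hp𝔭) (hLOC1fin 𝔭 (hS 𝔭 hp𝔭)) hCRK

end DualBasisFullAt

section CurveFullAt

variable {K : Type} [Field K] [NumberField K] {S : Set (HeightOneSpectrum (𝓞 K))} {p : ℕ} [Fact p.Prime]
  (W : WeierstrassCurve K) [W.IsElliptic]
  [TopologicalSpace (PowerSeries ℤ_[p])] [IsTopologicalRing (PowerSeries ℤ_[p])]
  [IsTopologicalAddGroup (BigRepModule ℤ_[p] p (PrimaryTorsion W.geomPoints p))]
  [ContinuousSMul (PowerSeries ℤ_[p]) (BigRepModule ℤ_[p] p (PrimaryTorsion W.geomPoints p))]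
  (hS : ∀ v : HeightOneSpectrum (𝓞 K), ((p : ℕ) : 𝓞 K) ∈ v.asIdeal → v ∈ S)
  (κ : ZpExtension K p)
  (ρ₀ : ContinuousRep (GaloisGroupUnramifiedOutside K S) ℤ_[p] (PrimaryTorsion W.geomPoints p))

/-- **`S_{𝓛_v}(K, 𝐃_E)` IS ALMOST `Λ`-DIVISIBLE** — Greenberg 2016 Prop. 4.1.1 (c) for `𝐃_E = E[p^∞] ⊗ Λ^*(κ⁻¹)` and the fullAt
specification (`⊤` at `v`, `0` at every other place of `Σ`; Shapiro image = Castella's PRIMITIVE `Sel_{v̄}(K_∞, E[p^∞])`): for an elliptic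
`W/K`, `K` imaginary quadratic, `p = v v̄`, `S ⊇ {w ∣ p}` finite with a `σ`-supply, ANY continuous `ℤ_p`-linear `ρ₀` on `E[p^∞]`: every
Pontryagin dual of `S_{𝓛_v}(K, 𝐃_E)` has no non-zero pseudo-null (= finite) `Λ`-submodule, GRANTED Greenberg 2016 Prop. 4.1.1 and Greenberg
2006 Props. 4.1, 4.2, 3.2 BY NAME and `corank_Λ S_{𝓛_v}(K, 𝐃_E) = 0` (x1-w3 g3's `hasCorank_fullAtSelmer_zero_of_xAc`).
[cite: Greenberg2016Selmer, Prop. 4.1.1 (c) (§4.1 p. 15 L21–32), §4.3 pp. 20–21] [cite: Greenberg2006, Props. 3.2, 4.1, 4.2, §5 A]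
[cite: CastellaGrossiLeeSkinner2022, Cor. 1.4.3] [cite: PollackWeston2011, App. A Prop. A.2] -/
theorem primaryTorsion_fullAtSelmer_isAlmostDivisible (h411 : prop411_selmer_isAlmostDivisible)
    (h41 : prop41_globalEulerPoincareCorank) (h42 : prop42_localEulerPoincareCorank)
    (h32 : prop32_cohomology_isCofinitelyGenerated)
    (hSf : S.Finite) (hK : IsImaginaryQuadratic K)
    (hsup : ∀ v : HeightOneSpectrum (𝓞 K), v ∈ S →
      ∃ σ : absoluteGaloisGroup (Place.Completion (Sum.inr v : Place K)),
        κ (absGaloisRestrict K _ σ) ≠ 1)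
    {𝔭 𝔭bar : HeightOneSpectrum (𝓞 K)} (hne : 𝔭bar ≠ 𝔭)
    (hp𝔭 : ((p : ℕ) : 𝓞 K) ∈ 𝔭.asIdeal) (hp𝔭bar : ((p : ℕ) : 𝓞 K) ∈ 𝔭bar.asIdeal)
    (hSel : HasCorank (PowerSeries ℤ_[p])
      (fullAtSpecification S (bigRep (κ.liftUnramifiedOutside S hS) ρ₀) (Sum.inr 𝔭)).selmer 0) :
    IsAlmostDivisible (PowerSeries ℤ_[p])
      (fullAtSpecification S (bigRep (κ.liftUnramifiedOutside S hS) ρ₀) (Sum.inr 𝔭)).selmer := by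
  obtain ⟨hA, jQ, jU, hinjQ, hsurjQ, hinjU, hsurjU⟩ := exists_dualBases_primaryTorsion W p
  have hloc := fun v (hv : v ∈ S) ↦
    localH0_and_LOC1_primaryTorsion S W hS κ ρ₀ (Sum.inr v) (hsup v hv).choose (hsup v hv).choose_spec
  exact bigRep_fullAtSelmer_isAlmostDivisible_of_dualBasis hS κ ρ₀ h411 h41 h42 h32 hSf hK hA jQ hinjQ hsurjQ jU hinjU
    hsurjU (fun v hv ↦ (hloc v hv).1) (fun v hv ↦ (hloc v hv).2) hne hp𝔭 hp𝔭bar hSel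

end CurveFullAt

end Summit.BirchSwinnertonDyer.BirchSwinnertonDyer.Theorems.AcTwistDeformation

end
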